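import Summits.AtomisticToContinuum.FouriersLaw.Theorems.PhononMeanFreePathIncoherentChannelContactLossHelper2
import Summits.AtomisticToContinuum.FouriersLaw.Theorems.PhononMeanFreePathIncoherentChannelForecastNormMonotone
import Literature.Probability.Process.BrownianSupTail
/-!
# `IncoherentChannel`, line `two-horizons-forecast-loss` — N-UNIFORM CONTACT LOSS of the forecast norm

Helper file for the lead's stub `stub_forecastLoss` (the ENGINE) of crux `PhononMeanFreePath.IncoherentChannel`
(item stmt-AtomisticToContinuum-11811, route `PhononMeanFreePath`, sub-problem `FouriersLaw`), vocabulary of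
`PhononMeanFreePathDefs`: for the `(N+1)`-site pinned anharmonic chain `pinnedChain ω₂ lam β γ` with both baths at
`T` (`μ₀ = gibbsMeasure (N+1) T`, `K_t = transitionKernel (N+1) T T t⁺`, the CONSTRUCTED objects),
`v_t = fcast … N t = K_t p_N` is the mean forecast of the bath momentum `p_N` and `S_N(t) = fnorm … N t = ‖v_t‖²_{L²(μ₀)}`
the forecast norm (`S_N(0) = T`, non-increasing). The stub asks for an `N`-UNIFORM decay of `S_N` to `0`.

This file proves the first `N`-uniform dynamical bound on `S_N`: the bath at site `N` eats a FIXED FRACTION of the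
forecast norm in a time of order one, uniformly in the length of the chain,

  `S_N(t) ≤ T − t (√(2γT) − D √t)²`   for `0 ≤ t`, `D√t ≤ √(2γT)`,   `D = D(ω₂, lam, β, γ, T)` independent of `N`

(`contactLoss_fnorm_le`), hence `∃ δ > 0, t₀ > 0` independent of `N` with `S_N(t) ≤ (1 − δ) T` for all `N` and
all `t ≥ t₀` (`contactLoss_fnorm_le_uniform`). MECHANISM (a one-line Malliavin/Clark–Ocone computation done by
hand): on the product space `μ₀ ⊗ W` (initial Gibbs state, pair of bath Brownian motions) the unpredictable part
`p_N(t) − v_t(z)` has norm² `T − S_N(t)` and its projection on the right bath's own increment `B_t` is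
`E[p_N(t) B_t] = √(2γT)·t + E[B_t ∫₀ᵗ Y_N(z_s) ds]`, by the pathwise SDE `p_N(t) = p_N(0) + √(2γT) B_t + ∫₀ᵗ Y_N(z_s) ds`
(`Y_N = −∂_{q_N}H − γ p_N` the drift at the bath site); stationarity of the kernel process started from `μ₀` and
`N`-uniform Gibbs moments bound the last term by `t^{3/2} D`, and Cauchy–Schwarz gives
`(√(2γT) t − t^{3/2} D)² ≤ t (T − S_N(t))`. The bound holds at the harmonic corner `lam = β = 0` as well (every
input does): it certifies that the engine's `N`-uniform obstruction is NOT at the contact but in the ESCAPED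
(bulk) fraction of the forecast — the part that at `lam = β = 0` persists as the plateau of
`forecastLossEnvelope_false_harmonic`. Inputs (helpers 1–2 of this name): stationarity `(μ₀ ⊗ W).map Φ_r = μ₀`, the pathwise SDE of `p_N`, the
`N`-uniform Gibbs second moment of the bath-site drift and of its time integral; here: Brownian second moments
(`BrownianSupTail`), Cauchy–Schwarz on `μ₀ ⊗ W`, and `fnorm_antitone` for the uniform corollary.
No definitions of record (local abbreviations only); nothing here closes an item.
-/


noncomputable section

namespace Summit.AtomisticToContinuum.FouriersLaw.Theorems.PhononMeanFreePath

open MeasureTheory ProbabilityTheory Set Filter Topology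
open scoped NNReal ENNReal
open Literature.MathematicalPhysics.KineticTheory.HeatConduction
open Literature.MathematicalPhysics.KineticTheory Literature.Probability.Process OscillatorChain

/-! ### Assembly on the product space: the contact-loss inequality -/

section Core

variable {ω₂ lam β γ T : ℝ} (hω : 0 < ω₂) (hl : 0 ≤ lam) (hβ : 0 ≤ β) (hγ : 0 ≤ γ) (hT : 0 < T) (N : ℕ)
include hω hl hβ hγ hT

/-- **The contact-loss inequality at one `N`, given an `L²(μ₀)` bound `D²` on the bath-site drift**:
for `t ≥ 0` with `√t·√D² ≤ √(2γT)`, `S_N(t) ≤ T − t (√(2γT) − √t √D²)²`. On `μ₀ ⊗ W`: `E[(p_N(t) − v_t)²] = T − S_N(t)`,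
`E[(p_N(t) − v_t) B_t] = E[p_N(t) B_t] = √(2γT) t + E[B_t ∫₀ᵗ Y_N]`, `|E[B_t ∫₀ᵗ Y_N]| ≤ t^{3/2} √D²`, and
Cauchy–Schwarz. [folklore] -/
theorem contactLoss_fnorm_le_of_driftBound {Dsq : ℝ}
    (hDi : Integrable (fun z : PhaseSpace (N + 1) => ((pinnedChain ω₂ lam β γ).drift (N + 1) z).2 (Fin.last N) ^ 2)
      ((pinnedChain ω₂ lam β γ).gibbsMeasure (N + 1) T))
    (hD : ∫ z, ((pinnedChain ω₂ lam β γ).drift (N + 1) z).2 (Fin.last N) ^ 2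
      ∂((pinnedChain ω₂ lam β γ).gibbsMeasure (N + 1) T) ≤ Dsq)
    {t : ℝ} (ht : 0 ≤ t) (hsmall : Real.sqrt t * Real.sqrt Dsq ≤ Real.sqrt (2 * γ * T)) :
    fnorm ω₂ lam β γ T N t ≤ T - t * (Real.sqrt (2 * γ * T) - Real.sqrt t * Real.sqrt Dsq) ^ 2 := by
  set μ₀ := (pinnedChain ω₂ lam β γ).gibbsMeasure (N + 1) T with hμ₀
  haveI hμprob : IsProbabilityMeasure μ₀ := pinnedChain_isProbabilityMeasure_gibbsMeasure hω hl hβ γ (N + 1) hT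
  set Pμ : Measure (PhaseSpace (N + 1) × WienerPair) := μ₀.prod wienerPair with hPμ
  set b : Fin (N + 1) := Fin.last N with hb
  set t' : ℝ≥0 := t.toNNReal with ht'def
  have ht' : ((t' : ℝ≥0) : ℝ) = t := Real.coe_toNNReal t ht
  have hDsq0 : 0 ≤ Dsq := (integral_nonneg fun z => sq_nonneg _).trans hD
  -- the random variables
  set X : PhaseSpace (N + 1) × WienerPair → ℝ := fun p =>
    ((pinnedChain ω₂ lam β γ).solMap (N + 1) T T t p.1 (pairPath p.2)).2 b with hX
  set V : PhaseSpace (N + 1) × WienerPair → ℝ := fun p => fcast ω₂ lam β γ T N t p.1 with hV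
  set W : PhaseSpace (N + 1) × WienerPair → ℝ := fun p => brownian t' p.2.2 with hW
  set B1 : PhaseSpace (N + 1) × WienerPair → ℝ := fun p => brownian t' p.2.1 with hB1
  set P0 : PhaseSpace (N + 1) × WienerPair → ℝ := fun p => p.1.2 b with hP0
  set I : PhaseSpace (N + 1) × WienerPair → ℝ := fun p => ∫ s in (0 : ℝ)..t,
    ((pinnedChain ω₂ lam β γ).drift (N + 1)
      ((pinnedChain ω₂ lam β γ).solMap (N + 1) T T s p.1 (pairPath p.2))).2 b with hI
  set c : ℝ := Real.sqrt (2 * γ * T) with hc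
  set χ : ℝ := (if b.val = 0 then c else 0) with hχ
  have hc0 : 0 ≤ c := Real.sqrt_nonneg _
  -- the pathwise SDE
  have hsde : ∀ p, X p = P0 p + (χ * B1 p + c * W p) + I p := fun p => by
    have h := contactLoss_momentum_sde hω hl hβ hγ T N ht p.1 p.2
    simpa only [hX, hP0, hB1, hW, hI, hχ, hc, hb, ht'def] using h
  -- measurability
  have hXm : Measurable X :=
    (by fun_prop : Measurable fun y : PhaseSpace (N + 1) => y.2 b).comp
      (pinnedChain_measurable_solMap_pairPath hω hl hβ hγ (N + 1) T T t)
  obtain ⟨hvm, hv2, -, hv2le, -⟩ := lightCone_fcast_moments ω₂ lam β γ hω hl hβ hγ T hT N t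
  have hVm : Measurable V := hvm.comp measurable_fst
  have hWm : Measurable W := (measurable_brownian t').comp (measurable_snd.comp measurable_snd)
  have hB1m : Measurable B1 := (measurable_brownian t').comp (measurable_fst.comp measurable_snd)
  have hP0m : Measurable P0 := (by fun_prop : Measurable fun y : PhaseSpace (N + 1) => y.2 b).comp measurable_fst
  have hIeq : I = fun p => X p - P0 p - (χ * B1 p + c * W p) := by
    funext p; rw [hsde p]; ring
  have hIm : Measurable I := by
    rw [hIeq]
    exact (hXm.sub hP0m).sub ((hB1m.const_mul χ).add (hWm.const_mul c))
  -- second moments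
  obtain ⟨hip, hbp⟩ := commonPastBound_gibbsEvenMoments ω₂ lam β γ hω hl hβ T hT (N + 1) b 1
  simp only [Nat.mul_one] at hip hbp
  simp only [pow_one, Finset.range_one, Finset.prod_singleton, Nat.cast_zero, mul_zero, zero_add, mul_one] at hbp
  have hpm : StronglyMeasurable fun y : PhaseSpace (N + 1) => y.2 b :=
    (by fun_prop : Continuous fun y : PhaseSpace (N + 1) => y.2 b).stronglyMeasurable
  have hp2m : StronglyMeasurable fun y : PhaseSpace (N + 1) => y.2 b ^ 2 :=
    (by fun_prop : Continuous fun y : PhaseSpace (N + 1) => y.2 b ^ 2).stronglyMeasurable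
  have hpi : Integrable (fun y : PhaseSpace (N + 1) => y.2 b) μ₀ :=
    ((memLp_two_iff_integrable_sq hpm.aestronglyMeasurable).2 hip).integrable one_le_two
  -- X
  have hX2 : Integrable (fun p => X p ^ 2) Pμ ∧ ∫ p, X p ^ 2 ∂Pμ = T := by
    obtain ⟨h1, h2⟩ := contactLoss_integral_solMap_prod hω hl hβ hγ hT N t' hp2m hip
    rw [ht'] at h1 h2
    rw [hbp] at h2
    exact ⟨h1, h2⟩
  have hXi : Integrable X Pμ := by
    obtain ⟨h1, -⟩ := contactLoss_integral_solMap_prod hω hl hβ hγ hT N t' hpm hpi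
    rw [ht'] at h1
    exact h1
  -- V
  have hV2 : Integrable (fun p => V p ^ 2) Pμ := hv2.comp_fst wienerPair
  have hV2val : ∫ p, V p ^ 2 ∂Pμ = fnorm ω₂ lam β γ T N t := by
    have h := integral_fun_fst (μ := μ₀) (ν := wienerPair) (fun z => fcast ω₂ lam β γ T N t z ^ 2)
    rw [probReal_univ, one_smul] at h
    exact h
  -- W
  have hW2 : Integrable (fun p => W p ^ 2) Pμ := (integrable_brownian_snd_pow t' 2).comp_snd μ₀
  have hW2val : ∫ p, W p ^ 2 ∂Pμ = t := by
    have h := integral_fun_snd (μ := μ₀) (ν := wienerPair) (fun ω : WienerPair => brownian t' ω.2 ^ 2)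
    rw [probReal_univ, one_smul, integral_brownian_snd_sq] at h
    rw [← ht']; exact h
  have hB12 : Integrable (fun p => B1 p ^ 2) Pμ := (integrable_brownian_fst_pow t' 2).comp_snd μ₀
  have hP02 : Integrable (fun p => P0 p ^ 2) Pμ := hip.comp_fst wienerPair
  -- products with W
  have hXVi : Integrable (fun p => X p * V p) Pμ :=
    lightCone_integrable_mul_of_sq hXm.aestronglyMeasurable hVm.aestronglyMeasurable hX2.1 hV2
  have hP0Wi : Integrable (fun p => P0 p * W p) Pμ :=
    lightCone_integrable_mul_of_sq hP0m.aestronglyMeasurable hWm.aestronglyMeasurable hP02 hW2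
  have hB1Wi : Integrable (fun p => B1 p * W p) Pμ :=
    lightCone_integrable_mul_of_sq hB1m.aestronglyMeasurable hWm.aestronglyMeasurable hB12 hW2
  have hP0W : ∫ p, P0 p * W p ∂Pμ = 0 := by
    have h := integral_prod_mul (μ := μ₀) (ν := wienerPair) (fun z : PhaseSpace (N + 1) => z.2 b)
      (fun ω : WienerPair => brownian t' ω.2)
    rw [integral_brownian_snd, mul_zero] at h
    exact h
  have hB1W : ∫ p, B1 p * W p ∂Pμ = 0 := by
    have h := integral_fun_snd (μ := μ₀) (ν := wienerPair) (fun ω : WienerPair => brownian t' ω.1 * brownian t' ω.2)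
    rw [probReal_univ, one_smul, integral_brownian_fst_mul_brownian_snd] at h
    exact h
  have hVW : ∫ p, V p * W p ∂Pμ = 0 := by
    have h := integral_prod_mul (μ := μ₀) (ν := wienerPair) (fun z : PhaseSpace (N + 1) => fcast ω₂ lam β γ T N t z)
      (fun ω : WienerPair => brownian t' ω.2)
    rw [integral_brownian_snd, mul_zero] at h
    exact h
  -- the integrated drift
  have hIlint : ∫⁻ p, ENNReal.ofReal (I p ^ 2) ∂Pμ ≤ ENNReal.ofReal (t ^ 2 * Dsq) :=
    contactLoss_lintegral_driftIntegral_sq_le hω hl hβ hγ hT N ht hDi hD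
  have hI2 : Integrable (fun p => I p ^ 2) Pμ :=
    ⟨(hIm.pow_const 2).aestronglyMeasurable,
      (hasFiniteIntegral_iff_ofReal (ae_of_all _ fun p => sq_nonneg (I p))).2
        (lt_of_le_of_lt hIlint ENNReal.ofReal_lt_top)⟩
  have hI2le : ∫ p, I p ^ 2 ∂Pμ ≤ t ^ 2 * Dsq := by
    rw [integral_eq_lintegral_of_nonneg_ae (ae_of_all _ fun p => sq_nonneg (I p))
      (hIm.pow_const 2).aestronglyMeasurable]
    exact ENNReal.toReal_le_of_le_ofReal (by positivity) hIlint
  have hIWi : Integrable (fun p => I p * W p) Pμ :=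
    lightCone_integrable_mul_of_sq hIm.aestronglyMeasurable hWm.aestronglyMeasurable hI2 hW2
  -- E[X W] = c t + E[I W]
  have hE : ∫ p, X p * W p ∂Pμ = c * t + ∫ p, I p * W p ∂Pμ := by
    have e : (fun p => X p * W p) = fun p => (P0 p * W p + χ * (B1 p * W p)) + (c * W p ^ 2 + I p * W p) := by
      funext p; rw [hsde p]; ring
    have hχB : Integrable (fun p => χ * (B1 p * W p)) Pμ := hB1Wi.const_mul χ
    have hcW : Integrable (fun p => c * W p ^ 2) Pμ := hW2.const_mul c
    have h12 : Integrable (fun p => P0 p * W p + χ * (B1 p * W p)) Pμ := hP0Wi.add hχB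
    have h34 : Integrable (fun p => c * W p ^ 2 + I p * W p) Pμ := hcW.add hIWi
    rw [e, integral_add h12 h34, integral_add hP0Wi hχB, integral_add hcW hIWi, integral_const_mul,
      integral_const_mul, hP0W, hB1W, hW2val]
    ring
  -- E[X V] = S and E[(X - V)²] = T - S
  have hXV : ∫ p, X p * V p ∂Pμ = fnorm ω₂ lam β γ T N t := by
    rw [integral_prod _ hXVi]
    have hin : ∀ z : PhaseSpace (N + 1), ∫ ω, X (z, ω) * V (z, ω) ∂wienerPair = fcast ω₂ lam β γ T N t z ^ 2 := by
      intro z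
      simp only [hX, hV]
      rw [integral_mul_const, ← lightCone_fcast_eq_integral_solMap hω hl hβ hγ N ht z, sq]
    simp_rw [hin]
    rfl
  have hdev2 : Integrable (fun p => (X p - V p) ^ 2) Pμ ∧ ∫ p, (X p - V p) ^ 2 ∂Pμ = T - fnorm ω₂ lam β γ T N t := by
    have e : (fun p => (X p - V p) ^ 2) = fun p => (X p ^ 2 - 2 * (X p * V p)) + V p ^ 2 := by
      funext p; ring
    rw [e]
    have h2XV : Integrable (fun p => 2 * (X p * V p)) Pμ := hXVi.const_mul 2
    have h12 : Integrable (fun p => X p ^ 2 - 2 * (X p * V p)) Pμ := hX2.1.sub h2XV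
    refine ⟨h12.add hV2, ?_⟩
    rw [integral_add h12 hV2, integral_sub hX2.1 h2XV, integral_const_mul, hX2.2, hXV, hV2val]
    ring
  -- Cauchy–Schwarz, twice
  have hCS1 : (∫ p, X p * W p ∂Pμ) ^ 2 ≤ (T - fnorm ω₂ lam β γ T N t) * t := by
    have h := lightCone_integral_mul_sq_le (μ := Pμ) (f := fun p => X p - V p) (g := W)
      (hXm.sub hVm).aestronglyMeasurable hWm.aestronglyMeasurable hdev2.1 hW2
    have e : ∫ p, (X p - V p) * W p ∂Pμ = ∫ p, X p * W p ∂Pμ := by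
      have e1 : (fun p => (X p - V p) * W p) = fun p => X p * W p - V p * W p := by funext p; ring
      rw [e1, integral_sub (lightCone_integrable_mul_of_sq hXm.aestronglyMeasurable hWm.aestronglyMeasurable hX2.1 hW2)
        (lightCone_integrable_mul_of_sq hVm.aestronglyMeasurable hWm.aestronglyMeasurable hV2 hW2), hVW, sub_zero]
    rw [e, hdev2.2, hW2val] at h
    exact h
  have hCS2 : (∫ p, I p * W p ∂Pμ) ^ 2 ≤ t ^ 2 * Dsq * t := by
    have h := lightCone_integral_mul_sq_le (μ := Pμ) (f := I) (g := W)
      hIm.aestronglyMeasurable hWm.aestronglyMeasurable hI2 hW2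
    rw [hW2val] at h
    exact h.trans (mul_le_mul_of_nonneg_right hI2le ht)
  -- the elementary endgame
  have hS_le_T : fnorm ω₂ lam β γ T N t ≤ T := hv2le
  set S := fnorm ω₂ lam β γ T N t with hS
  set E := ∫ p, X p * W p ∂Pμ with hEdef
  set J := ∫ p, I p * W p ∂Pμ with hJdef
  set ρ : ℝ := t * Real.sqrt t * Real.sqrt Dsq with hρ
  have hst : Real.sqrt t ^ 2 = t := Real.sq_sqrt ht
  have hsD : Real.sqrt Dsq ^ 2 = Dsq := Real.sq_sqrt hDsq0
  have hρ2 : ρ ^ 2 = t ^ 2 * Dsq * t := by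
    simp only [hρ]; rw [mul_pow, mul_pow, hst, hsD]; ring
  have hρ0 : 0 ≤ ρ := by positivity
  have hJ : -ρ ≤ J := by
    have : J ^ 2 ≤ ρ ^ 2 := by rw [hρ2]; exact hCS2
    exact (abs_le_of_sq_le_sq' this hρ0).1
  have hctρ : c * t - ρ = t * (c - Real.sqrt t * Real.sqrt Dsq) := by
    simp only [hρ]; ring
  have hgap : 0 ≤ c - Real.sqrt t * Real.sqrt Dsq := sub_nonneg.2 hsmall
  have hctρ0 : 0 ≤ c * t - ρ := by rw [hctρ]; positivity
  have hE_ge : c * t - ρ ≤ E := by rw [hE]; linarith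
  have hE2 : (c * t - ρ) ^ 2 ≤ E ^ 2 := pow_le_pow_left₀ hctρ0 hE_ge 2
  have hkey : t ^ 2 * (c - Real.sqrt t * Real.sqrt Dsq) ^ 2 ≤ (T - S) * t := by
    have := hE2.trans hCS1
    rw [hctρ, mul_pow] at this
    exact this
  rcases eq_or_lt_of_le ht with ht0 | htpos
  · rw [← ht0]; simp only [zero_mul, sub_zero]; exact hS_le_T
  · have : t * (c - Real.sqrt t * Real.sqrt Dsq) ^ 2 ≤ T - S := by
      have h2 : t * (t * (c - Real.sqrt t * Real.sqrt Dsq) ^ 2) ≤ t * (T - S) := by nlinarith [hkey]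
      exact le_of_mul_le_mul_left h2 htpos
    linarith

end Core

/-! ### The registered-vocabulary statements: `N`-uniform contact loss of the forecast norm -/

/-- **`N`-UNIFORM CONTACT LOSS OF THE FORECAST NORM.** For the pinned chain `pinnedChain ω₂ lam β γ`
(`ω₂ > 0`, `lam, β, γ ≥ 0`) with both baths at `T > 0` there is `D = D(ω₂, lam, β, γ, T) ≥ 0`, INDEPENDENT OF `N`,
such that for every `N` and every `t ≥ 0` with `D√t ≤ √(2γT)`:

  `S_N(t) = ‖K_t p_N‖²_{L²(μ₀)} ≤ T − t · (√(2γT) − D√t)²`.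

In particular `S_N(t) ≤ T − γT·t + O(t^{3/2})` uniformly in `N`: the bath at site `N` destroys forecast norm at
the full Ornstein–Uhlenbeck rate at small times, whatever the length of the chain. Mechanism: projection of the
unpredictable part `p_N(t) − v_t` on the right bath's own Brownian increment (pathwise SDE of `p_N`,
stationarity of the kernel process from `μ₀`, `N`-uniform Gibbs moments of the bath-site drift, Cauchy–Schwarz);
valid at the harmonic corner too. Registered helper for `stub_forecastLoss` (line `two-horizons-forecast-loss` of
crux `PhononMeanFreePath.IncoherentChannel`); it does not close the stub (whose content is the decay of the
ESCAPED fraction). [folklore] -/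
theorem contactLoss_fnorm_le : ∀ ω₂ lam β γ : ℝ, 0 < ω₂ → 0 ≤ lam → 0 ≤ β → 0 ≤ γ → ∀ T : ℝ, 0 < T →
    ∃ D : ℝ, 0 ≤ D ∧ ∀ (N : ℕ) (t : ℝ), 0 ≤ t → Real.sqrt t * D ≤ Real.sqrt (2 * γ * T) →
      fnorm ω₂ lam β γ T N t ≤ T - t * (Real.sqrt (2 * γ * T) - Real.sqrt t * D) ^ 2 := by
  intro ω₂ lam β γ hω hl hβ hγ T hT
  obtain ⟨Dsq, hDsq0, hDsq⟩ := contactLoss_drift_last_sq_gibbs (γ := γ) hω hl hβ hT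
  refine ⟨Real.sqrt Dsq, Real.sqrt_nonneg _, fun N t ht hsmall => ?_⟩
  obtain ⟨hDi, hD⟩ := hDsq N
  exact contactLoss_fnorm_le_of_driftBound hω hl hβ hγ hT N hDi hD ht hsmall

/-- **A FIXED FRACTION OF THE FORECAST NORM IS LOST IN A TIME OF ORDER ONE, UNIFORMLY IN `N`.** For all
parameters `> 0` and `T > 0` there are `δ > 0` and `t₀ > 0`, INDEPENDENT OF `N`, with

  `S_N(t) ≤ (1 − δ)·T`   for every `N` and every `t ≥ t₀`

(`contactLoss_fnorm_le` at `t₀ = 2γT/(4D'²)`, `D' = max(D,1)`, where the loss is `≥ γ²T²/(4D'²)`, then the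
monotonicity `fnorm_antitone`). The stub `stub_forecastLoss` asks for `S_N → 0` `N`-uniformly; this is its
contact part, the remaining (escaped) fraction being the open content. [folklore] -/
theorem contactLoss_fnorm_le_uniform : ∀ ω₂ lam β γ : ℝ, 0 < ω₂ → 0 < lam → 0 < β → 0 < γ → ∀ T : ℝ, 0 < T →
    ∃ δ t₀ : ℝ, 0 < δ ∧ 0 < t₀ ∧ ∀ (N : ℕ) (t : ℝ), t₀ ≤ t → fnorm ω₂ lam β γ T N t ≤ (1 - δ) * T := by
  intro ω₂ lam β γ hω hl hβ hγ T hT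
  obtain ⟨D, hD0, hD⟩ := contactLoss_fnorm_le ω₂ lam β γ hω hl.le hβ.le hγ.le T hT
  set D' : ℝ := max D 1 with hD'
  have hD'1 : 1 ≤ D' := le_max_right _ _
  have hD'0 : 0 < D' := lt_of_lt_of_le one_pos hD'1
  have hDD' : D ≤ D' := le_max_left _ _
  set c : ℝ := Real.sqrt (2 * γ * T) with hc
  have hc2 : c ^ 2 = 2 * γ * T := Real.sq_sqrt (by positivity)
  have hcpos : 0 < c := Real.sqrt_pos.2 (by positivity)
  set u : ℝ := c / (2 * D') with hu
  have hu0 : 0 ≤ u := by positivity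
  set t₀ : ℝ := u ^ 2 with ht₀
  have ht₀pos : 0 < t₀ := by positivity
  have hsqrt : Real.sqrt t₀ = u := Real.sqrt_sq hu0
  refine ⟨γ ^ 2 * T / (4 * D' ^ 2), t₀, by positivity, ht₀pos, fun N t ht => ?_⟩
  -- the contact-loss bound at `t₀`
  have hsmall : Real.sqrt t₀ * D ≤ c := by
    rw [hsqrt]
    calc u * D ≤ u * D' := mul_le_mul_of_nonneg_left hDD' hu0
      _ = c / 2 := by simp only [hu]; field_simp
      _ ≤ c := by linarith
  have hb := hD N t₀ ht₀pos.le hsmall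
  rw [hsqrt] at hb
  have hgap : c / 2 ≤ c - u * D := by
    have : u * D ≤ c / 2 := by
      calc u * D ≤ u * D' := mul_le_mul_of_nonneg_left hDD' hu0
        _ = c / 2 := by simp only [hu]; field_simp
    linarith
  have hsq : (c / 2) ^ 2 ≤ (c - u * D) ^ 2 := pow_le_pow_left₀ (by positivity) hgap 2
  have hloss : γ ^ 2 * T / (4 * D' ^ 2) * T ≤ t₀ * (c - u * D) ^ 2 := by
    calc γ ^ 2 * T / (4 * D' ^ 2) * T = t₀ * (c / 2) ^ 2 := by
          simp only [ht₀, hu]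
          field_simp
          nlinarith [hc2]
      _ ≤ t₀ * (c - u * D) ^ 2 := mul_le_mul_of_nonneg_left hsq ht₀pos.le
  -- monotonicity in time
  have hmono := fnorm_antitone ω₂ lam β γ hω hl hβ hγ T hT N t₀ t ht₀pos.le ht
  calc fnorm ω₂ lam β γ T N t ≤ fnorm ω₂ lam β γ T N t₀ := hmono
    _ ≤ T - t₀ * (c - u * D) ^ 2 := hb
    _ ≤ (1 - γ ^ 2 * T / (4 * D' ^ 2)) * T := by nlinarith [hloss]

end Summit.AtomisticToContinuum.FouriersLaw.Theorems.PhononMeanFreePath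

end
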